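import Summits.QuantumFields.BalabanUV.Beta.GAN24.TorusCoveringOps
import Summits.QuantumFields.BalabanUV.Beta.GAN24.TorusCoveringDeckSum

/-!
# G-an2-4 ∕ (CONV-C), INTERFACE REQUEST #12 (B5-1115-TABLE), row F12-E2r — supplier (D):
# KERNEL PERIODISATION ALONG A COVERING AND THE TRANSFER OF PER-BLOCK ROW BOUNDS FROM THE COVER TO THE BASE

G-an2-4 formalisation swarm `b2b-balaban-gan24-formalise-*`, leaf prover 02 (gen 42), crux team (2) under the coordinator ruling
«YM REDIRECT» (e34b3e0c); § II.F of `GAN24/Formal/LEAVES.md`, row **F12-E2r**, ROAD (r2) «covering ∕ periodisation bridge».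
An intertwining `K′ * pullV = pullV * K` (supplier (B) `TorusCoveringOps` proves it for the three (1.110) entry operators of
`Δ_a⁻¹ = (B5DeltaA169.DeltaA n M a)⁻¹`) says, entrywise, that the base kernel is the FIBRE SUM of the cover kernel:
`K (cov ĩ) x = Σ_{x̃ : cov x̃ = x} K′ ĩ x̃` (`kernel_periodise`).  Hence a block ROW sum of `K` is at most the sum of the block row
sums of `K′` over the DECK of the block (`block_row_sum_le`), and an exponential per-block row bound on the cover — the hypothesis shape of
leaf 04's `Entry110GradCubic.entry110Grad_of_block_row_sum` — descends to the base with the rate divided by `d+1` and the constant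
multiplied by `B4TorusKernel.periodConst δ d` (supplier (C) `TorusCoveringDeckSum.deck_sum_le`): **`block_row_bound_transfer`**.

## Contents (0 `def`, 0 `def … : Prop`, 0 cite, 0 sorry)
§1 `kernel_periodise`, `norm_kernel_le_fibre_sum`; §2 `block_row_sum_le` (any spacing `n`, unit tori `M ∣ M′`); §3 `torusSupNorm_translate_sub`,
**`block_row_bound_transfer`** (dimension `d+1`, constants `(B₁·periodConst δ d, δ/(d+1))` from `(B₁, δ)`).

HONEST SCOPE.  Finite sums and the deck sum; [folklore]∕[our bookkeeping]; nothing of [B5] asserted; no estimate of its own.  NOT (E2),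
NOT (CONV-C), NEVER «G-an2-4 closed», NOT NE2, NOT D1, NOT BetaPertH, NOT continuum, NOT Clay; not in print — our bookkeeping.  HONEST
DEPENDENCY: continuum YM on T⁴ ⇐ BetaPertH ∧ nine spine estimates (0/9 proved); BetaPertH ⇐ (D1) ∧ (D4) ∧ CAP+tail; G-an2-4 gates asym,
D1 and NE2/3/4.
-/

noncomputable section

open scoped BigOperators Matrix
open Finset

namespace Summit.QuantumFields.BalabanUV.Beta.GAN24.TorusCoveringRowSum

open Literature.MathematicalPhysics.QuantumFieldTheory.Balaban1983to89
open B5Prop11Plancherel (Tor fine)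
open B5Blocks16 (blockOf)
open B4TorusKernel (periodConst)
open B4TorusKernel.MultiPeriod (torusSupNorm torusSupNorm_translate translate translate_apply)
open B5Kernel166Decay (periodConst_pos)
open B6LowerBound2153Torus (rep)
open TorusCovering (cov pullV hfine cov_surjective blockOf_cov mul_pullV_apply pullV_mul_apply exists_rep_eq_translate)
open TorusCoveringDeckSum (deck_sum_le)

variable {d : ℕ}

/-! ## §1 Kernel periodisation -/

section Periodise

variable {N N' : Fin d → ℕ} [hN : ∀ μ, NeZero (N μ)] [hN' : ∀ μ, NeZero (N' μ)] (h : ∀ μ, N μ ∣ N' μ)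

/-- **KERNEL PERIODISATION**: an intertwining `K′ * pullV = pullV * K` says that the base kernel at an image row is the fibre sum of
the cover kernel: `K (cov ĩ.1, ĩ.2) (x, ν) = Σ_{ỹ : cov ỹ = x} K′ ĩ (ỹ, ν)`. [folklore] -/
theorem kernel_periodise {K' : Matrix (Tor N' × Fin d) (Tor N' × Fin d) ℂ} {K : Matrix (Tor N × Fin d) (Tor N × Fin d) ℂ}
    (hK : K' * pullV h = pullV h * K) (i' : Tor N' × Fin d) (j : Tor N × Fin d) :
    K (cov h i'.1, i'.2) j = ∑ y' : Tor N', (if cov h y' = j.1 then K' i' (y', j.2) else 0) := by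
  have e := congrFun (congrFun hK i') j
  rw [mul_pullV_apply, pullV_mul_apply] at e
  exact e.symm

/-- … hence `‖K (cov ĩ) (x, ν)‖ ≤ Σ_{ỹ : cov ỹ = x} ‖K′ ĩ (ỹ, ν)‖`. [folklore] -/
theorem norm_kernel_le_fibre_sum {K' : Matrix (Tor N' × Fin d) (Tor N' × Fin d) ℂ}
    {K : Matrix (Tor N × Fin d) (Tor N × Fin d) ℂ} (hK : K' * pullV h = pullV h * K) (i' : Tor N' × Fin d)
    (j : Tor N × Fin d) :
    ‖K (cov h i'.1, i'.2) j‖ ≤ ∑ y' : Tor N', (if cov h y' = j.1 then ‖K' i' (y', j.2)‖ else 0) := by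
  rw [kernel_periodise h hK]
  refine (norm_sum_le _ _).trans (le_of_eq (Finset.sum_congr rfl fun y' _ => ?_))
  split_ifs <;> simp

end Periodise

/-! ## §2 Block row sums descend along the deck -/

section Blocks

variable (n : ℕ) [NeZero n] {M M' : Fin d → ℕ} [hM : ∀ μ, NeZero (M μ)] [hM' : ∀ μ, NeZero (M' μ)] (h : ∀ μ, M μ ∣ M' μ)

/-- **BLOCK ROW SUMS DESCEND**: for an intertwining pair `K′ * pullV = pullV * K` on the fine tori over `M ∣ M′`, the `B(y)`-block row
sum of `K` at an image row is at most the sum, over the deck `{ỹ : cov ỹ = y}`, of the `B(ỹ)`-block row sums of `K′`. [folklore] -/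
theorem block_row_sum_le {K' : Matrix (Tor (fine n M') × Fin d) (Tor (fine n M') × Fin d) ℂ}
    {K : Matrix (Tor (fine n M) × Fin d) (Tor (fine n M) × Fin d) ℂ}
    (hK : K' * pullV (hfine n h) = pullV (hfine n h) * K) (i' : Tor (fine n M') × Fin d) (y : Tor M) :
    ∑ x : Tor (fine n M) × Fin d, (if blockOf n M x.1 = y then ‖K (cov (hfine n h) i'.1, i'.2) x‖ else 0)
      ≤ ∑ y' ∈ Finset.univ.filter (fun y' : Tor M' => cov h y' = y),
          ∑ x' : Tor (fine n M') × Fin d, (if blockOf n M' x'.1 = y' then ‖K' i' x'‖ else 0) := by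
  -- abbreviation for the cover entries
  set G : Tor (fine n M') × Fin d → ℝ := fun x' => ‖K' i' x'‖ with hG
  have hG0 : ∀ x', 0 ≤ G x' := fun x' => norm_nonneg _
  -- (1) periodise each base entry
  have step1 : ∑ x : Tor (fine n M) × Fin d, (if blockOf n M x.1 = y then ‖K (cov (hfine n h) i'.1, i'.2) x‖ else 0)
      ≤ ∑ x : Tor (fine n M) × Fin d, (if blockOf n M x.1 = y then
          ∑ y' : Tor (fine n M'), (if cov (hfine n h) y' = x.1 then G (y', x.2) else 0) else 0) := by
    refine Finset.sum_le_sum fun x _ => ?_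
    split_ifs with hb
    · exact norm_kernel_le_fibre_sum (hfine n h) hK i' x
    · exact le_rfl
  -- (2) the double sum is the sum of `G` over the cover entries whose image lies in `B(y)`
  have inner : ∀ (x₁ : Tor (fine n M)) (κ : Fin d),
      (if blockOf n M x₁ = y then ∑ y' : Tor (fine n M'), (if cov (hfine n h) y' = x₁ then G (y', κ) else 0) else 0)
        = ∑ y' : Tor (fine n M'), (if cov (hfine n h) y' = x₁ then
            (if blockOf n M (cov (hfine n h) y') = y then G (y', κ) else 0) else 0) := by
    intro x₁ κ
    split_ifs with hb
    · refine Finset.sum_congr rfl fun y' _ => ?_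
      by_cases hc : cov (hfine n h) y' = x₁
      · rw [if_pos hc, if_pos hc, hc, if_pos hb]
      · rw [if_neg hc, if_neg hc]
    · symm
      refine Finset.sum_eq_zero fun y' _ => ?_
      by_cases hc : cov (hfine n h) y' = x₁
      · rw [if_pos hc, hc, if_neg hb]
      · rw [if_neg hc]
  have step2 : (∑ x : Tor (fine n M) × Fin d, (if blockOf n M x.1 = y then
          ∑ y' : Tor (fine n M'), (if cov (hfine n h) y' = x.1 then G (y', x.2) else 0) else 0))
      = ∑ x' : Tor (fine n M') × Fin d, (if blockOf n M (cov (hfine n h) x'.1) = y then G x' else 0) := by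
    calc (∑ x : Tor (fine n M) × Fin d, (if blockOf n M x.1 = y then
            ∑ y' : Tor (fine n M'), (if cov (hfine n h) y' = x.1 then G (y', x.2) else 0) else 0))
        = ∑ x₁ : Tor (fine n M), ∑ κ : Fin d, ∑ y' : Tor (fine n M'), (if cov (hfine n h) y' = x₁ then
            (if blockOf n M (cov (hfine n h) y') = y then G (y', κ) else 0) else 0) := by
          rw [Fintype.sum_prod_type]
          exact Finset.sum_congr rfl fun x₁ _ => Finset.sum_congr rfl fun κ _ => inner x₁ κ
      _ = ∑ κ : Fin d, ∑ x₁ : Tor (fine n M), ∑ y' : Tor (fine n M'), (if cov (hfine n h) y' = x₁ then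
            (if blockOf n M (cov (hfine n h) y') = y then G (y', κ) else 0) else 0) := Finset.sum_comm
      _ = ∑ κ : Fin d, ∑ y' : Tor (fine n M'), ∑ x₁ : Tor (fine n M), (if cov (hfine n h) y' = x₁ then
            (if blockOf n M (cov (hfine n h) y') = y then G (y', κ) else 0) else 0) :=
          Finset.sum_congr rfl fun κ _ => Finset.sum_comm
      _ = ∑ κ : Fin d, ∑ y' : Tor (fine n M'), (if blockOf n M (cov (hfine n h) y') = y then G (y', κ) else 0) := by
          refine Finset.sum_congr rfl fun κ _ => Finset.sum_congr rfl fun y' _ => ?_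
          rw [Finset.sum_ite_eq]
          simp only [Finset.mem_univ, if_true]
      _ = ∑ y' : Tor (fine n M'), ∑ κ : Fin d, (if blockOf n M (cov (hfine n h) y') = y then G (y', κ) else 0) :=
          Finset.sum_comm
      _ = ∑ x' : Tor (fine n M') × Fin d, (if blockOf n M (cov (hfine n h) x'.1) = y then G x' else 0) := by
          rw [Fintype.sum_prod_type]
  -- (3) group the cover entries by their own block; the blocks over `y` are the deck
  have step3 : ∑ x' : Tor (fine n M') × Fin d, (if blockOf n M (cov (hfine n h) x'.1) = y then G x' else 0)
      = ∑ y' ∈ Finset.univ.filter (fun y' : Tor M' => cov h y' = y),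
          ∑ x' : Tor (fine n M') × Fin d, (if blockOf n M' x'.1 = y' then G x' else 0) := by
    rw [Finset.sum_comm]
    refine Finset.sum_congr rfl fun x' _ => ?_
    rw [Finset.sum_ite_eq, blockOf_cov n h]
    simp only [Finset.mem_filter, Finset.mem_univ, true_and]
  exact step1.trans (le_of_eq (step2.trans step3))

end Blocks

/-! ## §3 The transfer of an exponential per-block row bound -/

omit d in
/-- the torus sup-distance is blind to a period translation of the first argument of a difference. [folklore] -/
theorem torusSupNorm_translate_sub {d : ℕ} (M : Fin (d + 1) → ℕ) (a b m : Fin (d + 1) → ℤ) :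
    torusSupNorm M (translate M a m - b) = torusSupNorm M (a - b) := by
  have e : translate M a m - b = translate M (a - b) m := by
    funext i; simp only [Pi.sub_apply, translate_apply]; ring
  rw [e, torusSupNorm_translate]

/-- **TRANSFER OF A PER-BLOCK ROW BOUND FROM THE COVER TO THE BASE.**  Let `M ∣ M′` (dimension `d+1`, spacing `n`) and let
`K′ * pullV = pullV * K`.  If every row `ĩ` of `K′` has block row sums `Σ_{x̃′ ∈ B(ỹ′)} ‖K′ ĩ x̃′‖ ≤ B₁·e^{−δ·|rep(blockOf ĩ) − rep ỹ′|_{T′,∞}}`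
(`B₁ ≥ 0`, `δ > 0`), then every row `i` of `K` has block row sums
`Σ_{x′ ∈ B(y′)} ‖K i x′‖ ≤ B₁·periodConst δ d·e^{−(δ/(d+1))·|rep(blockOf i) − rep y′|_{T,∞}}` — the hypothesis shape of
`Entry110GradCubic.entry110Grad_of_block_row_sum`, with constants still depending on `(B₁, δ, d)` only. [folklore] -/
theorem block_row_bound_transfer (n : ℕ) [NeZero n] {M M' : Fin (d + 1) → ℕ} [∀ μ, NeZero (M μ)] [∀ μ, NeZero (M' μ)]
    (h : ∀ μ, M μ ∣ M' μ)
    {K' : Matrix (Tor (fine n M') × Fin (d + 1)) (Tor (fine n M') × Fin (d + 1)) ℂ}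
    {K : Matrix (Tor (fine n M) × Fin (d + 1)) (Tor (fine n M) × Fin (d + 1)) ℂ}
    (hK : K' * pullV (hfine n h) = pullV (hfine n h) * K) {B₁ δ : ℝ} (hB : 0 ≤ B₁) (hδ : 0 < δ)
    (hK' : ∀ (i' : Tor (fine n M') × Fin (d + 1)) (y' : Tor M'),
      ∑ x' : Tor (fine n M') × Fin (d + 1), (if blockOf n M' x'.1 = y' then ‖K' i' x'‖ else 0)
        ≤ B₁ * Real.exp (-(δ * torusSupNorm M' (rep M' (blockOf n M' i'.1) - rep M' y'))))
    (i : Tor (fine n M) × Fin (d + 1)) (y : Tor M) :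
    ∑ x : Tor (fine n M) × Fin (d + 1), (if blockOf n M x.1 = y then ‖K i x‖ else 0)
      ≤ B₁ * periodConst δ d * Real.exp (-(δ / (d + 1) * torusSupNorm M (rep M (blockOf n M i.1) - rep M y))) := by
  -- lift the row index
  obtain ⟨x₀, hx₀⟩ := cov_surjective (hfine n h) i.1
  have hi : i = (cov (hfine n h) (x₀, i.2).1, (x₀, i.2).2) := by rw [hx₀]
  set t : Fin (d + 1) → ℤ := rep M' (blockOf n M' x₀) with ht
  -- the deck-indexed bound
  have hdeck : ∑ y' ∈ Finset.univ.filter (fun y' : Tor M' => cov h y' = y),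
      ∑ x' : Tor (fine n M') × Fin (d + 1), (if blockOf n M' x'.1 = y' then ‖K' (x₀, i.2) x'‖ else 0)
        ≤ B₁ * ∑ y' ∈ Finset.univ.filter (fun y' : Tor M' => cov h y' = y),
            Real.exp (-(δ * torusSupNorm M' (t - rep M' y'))) := by
    rw [Finset.mul_sum]
    exact Finset.sum_le_sum fun y' _ => hK' (x₀, i.2) y'
  -- the base distance: `t` and `rep (blockOf i)` differ by a period of `M`
  have hdist : torusSupNorm M (t - rep M y) = torusSupNorm M (rep M (blockOf n M i.1) - rep M y) := by
    obtain ⟨m, hm⟩ := exists_rep_eq_translate h (blockOf n M' x₀)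
    rw [ht, hm, torusSupNorm_translate_sub, ← blockOf_cov n h, hx₀]
  calc ∑ x : Tor (fine n M) × Fin (d + 1), (if blockOf n M x.1 = y then ‖K i x‖ else 0)
      = ∑ x : Tor (fine n M) × Fin (d + 1),
          (if blockOf n M x.1 = y then ‖K (cov (hfine n h) (x₀, i.2).1, (x₀, i.2).2) x‖ else 0) := by rw [← hi]
    _ ≤ ∑ y' ∈ Finset.univ.filter (fun y' : Tor M' => cov h y' = y),
          ∑ x' : Tor (fine n M') × Fin (d + 1), (if blockOf n M' x'.1 = y' then ‖K' (x₀, i.2) x'‖ else 0) :=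
        block_row_sum_le n h hK (x₀, i.2) y
    _ ≤ B₁ * ∑ y' ∈ Finset.univ.filter (fun y' : Tor M' => cov h y' = y),
          Real.exp (-(δ * torusSupNorm M' (t - rep M' y'))) := hdeck
    _ ≤ B₁ * (periodConst δ d * Real.exp (-(δ / (d + 1) * torusSupNorm M (t - rep M y)))) :=
        mul_le_mul_of_nonneg_left (deck_sum_le h hδ t y) hB
    _ = B₁ * periodConst δ d * Real.exp (-(δ / (d + 1) * torusSupNorm M (rep M (blockOf n M i.1) - rep M y))) := by
        rw [hdist, mul_assoc]

end Summit.QuantumFields.BalabanUV.Beta.GAN24.TorusCoveringRowSum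

end
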